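import Summits.QuantumFields.YangMills.Theorems.BalabanUVNodesPortU8IotaC2Transport

/-!
# PORT PT-B (U8), file 6 — LINEARISATION of the `log 𝐔`-block ([15] (182) read in the chart): `D log(1) = id`, the responses `recordGkJ` on the `𝐔`-coordinates ARE the
# 𝔰𝔩₂-coordinates of the derivative `DU(0)` of the rooted-gauge background field, `DU(0)[δ](b)` is traceless, and the `𝐔`-block chart matrix of a cut response IS `DU(0)[δ](b)`

Cell `ym-nodeO-ideate` ∕ `ym-balaban-port`, porter `ymgap-nodeO-port-PTB-1` (gen 0), item **stmt-QuantumFields-27931** `BalabanUVNodes.PortPieceLocalityU8` (string ⁶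
`nodeO-cover/TYPER-Sig27931-v6-J.txt`, sha16 `3e2971674efa3b12`); PORT-PLAN-v1 row U8-C1 (first transport step); `--kind proof --supports stmt-QuantumFields-27931` (helper).
[I] = [Balaban1987RG1], [15] = [Balaban1985Variational], [B7] = [Balaban1985Averaging].  CONSUMED BY NAME: DEF-1's names (`recordBgField ∕ recordEmbJ ∕ recordGkJ ∕ recordCXJ ∕
chartMatU ∕ sl2Coord ∕ sl2Gen ∕ domBonds`, `sl2Coord_add ∕ _smul`), files 1 and 5 (`PortU8.recordBgField_zero`), the tree's `MatrixLog.analyticAt_mlog ∕ exp_mlog ∕ mlog_one`,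
Mathlib's `hasFDerivAt_exp_zero`, `HasFDerivAt.unique`, `hasFDerivAt_pi'`, `Matrix.det_fin_two ∕ trace_fin_two`, `B12FormatPlus.cutTo_apply`.
WHAT THIS FILE PROVES (theorems only; no `def ∕ instance ∕ notation ∕ sorry`; standard axioms).
§1 ★ `hasFDerivAt_mlog_one(_real)` — the series logarithm (21) has derivative the identity at `1` (`exp ∘ log = id` near `1`, `D exp(0) = id`, uniqueness of the derivative).
§2 `hasFDerivAt_sl2Coord` — each 𝔰𝔩₂-coordinate is a continuous ℝ-linear functional (its own derivative).
§3 ★★ `hasFDerivAt_recordEmbJ_inl` ∕ ★★ `recordGkJ_inl_eq` — if `U : B ↦ (U_{k+1}(W_B)(b))_b` has derivative `U′` at `B = 0` (and the embedding is differentiable there), then on every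
   `𝐔`-coordinate `(b, c)`: `recordGkJ F θ k K a y (b, c) = sl2Coord (U′[δ_{y,a}](b)) c`, `δ_{y,a} = Pi.single y.1 (Pi.single y.2 (bV a))` — [15]'s functional derivative (182) in the chart.
§4 `sum_sl2Coord_smul_sl2Gen` (`Σ_c sl2Coord A c • τ_c = A − (tr A∕2)·1`), ★ `trace_eq_zero_of_hasFDerivAt_su` (the derivative of an `SU(2)`-valued family at a point where it is `1`
   is traceless: `det ≡ 1`), ★★ `chartMatU_cutTo_recordGkJ` — the `𝐔`-block chart matrix of the CUT response `cutTo (recordCXJ X) (recordGkJ … a y)` on a bond `b` is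
   `U′[δ_{y,a}](b)` if `b ∈ X` and `0` otherwise: the quantity the first three (scaled) clauses of print's (4.4) domain `recordDom44J` measure in row (R1ᴰ).
RESIDUE RECORDED: with files 5–6, rows (R1ᴰ)∕(C2a) of 27931⁶ are statements about `U′ = DU(0)` (existence, `C²`, and the scaled decay `‖U′[δ_y](b)‖ ≲ ξ e^{−δ₀ dist}` with its
difference∕Laplacian companions, plus the linearised current for the `𝐉`-block) — [15] Thm 1 + Prop. 9 ∕ (190) AT `UkSel`; NOT proved here.
HONEST FRAMING.  Calculus and `2 × 2` algebra; NOTHING of Bałaban's analysis asserted, ported or discharged; 27931⁶ OPEN; K0⁷ NOT closed; NODE O 0∕1; COUNT 8∕28 · K 1∕4 UNMOVED;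
finite `𝕋⁴_{L^K}` at fixed ε — NOT continuum ∕ OS ∕ Clay; **the Yang–Mills mass gap (Clay) is NOT proved by any of this.**
-/

noncomputable section

open scoped BigOperators Matrix.Norms.L2Operator Topology

namespace Summit.QuantumFields.YangMills.Theorems.PortU8

open Literature.MathematicalPhysics.QuantumFieldTheory.Balaban1983to89
open Literature.MathematicalPhysics.QuantumFieldTheory.Balaban1983to89.Node00
open Literature.MathematicalPhysics.QuantumFieldTheory.Balaban1983to89.T4Continuum (T4Family)
open Summit.QuantumFields.YangMills.Theorems.K0RecordFormatNames
open NormedSpace (exp)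
open Filter

/-! ## §1  The series logarithm has derivative the identity at `1` -/

/-- **`D log (1) = id`** on `M₂(ℂ)`: the series logarithm (21) is the inverse of `exp` near `1` (`exp_mlog`) and `D exp (0) = id`. [cite: Balaban1985Averaging, (21) p.21] -/
theorem hasFDerivAt_mlog_one : HasFDerivAt (MatrixLog.mlog : MatA 2 → MatA 2) (ContinuousLinearMap.id ℂ (MatA 2)) 1 := by
  have hd : DifferentiableAt ℂ (MatrixLog.mlog : MatA 2 → MatA 2) 1 := (MatrixLog.analyticAt_mlog (by simp)).differentiableAt
  set L := fderiv ℂ (MatrixLog.mlog : MatA 2 → MatA 2) 1 with hL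
  have hm : HasFDerivAt (MatrixLog.mlog : MatA 2 → MatA 2) L 1 := hd.hasFDerivAt
  have he : HasFDerivAt (exp : MatA 2 → MatA 2) (1 : MatA 2 →L[ℂ] MatA 2) (MatrixLog.mlog (1 : MatA 2)) := by
    rw [MatrixLog.mlog_one]; exact hasFDerivAt_exp_zero
  have hcomp : HasFDerivAt (fun X : MatA 2 => exp (MatrixLog.mlog X)) ((1 : MatA 2 →L[ℂ] MatA 2).comp L) 1 := he.comp 1 hm
  have hev : (fun X : MatA 2 => exp (MatrixLog.mlog X)) =ᶠ[𝓝 1] id := by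
    have hopen : IsOpen {X : MatA 2 | ‖X - 1‖ < 1} := isOpen_lt (continuous_norm.comp (continuous_id.sub continuous_const)) continuous_const
    filter_upwards [hopen.mem_nhds (by simp : (1 : MatA 2) ∈ {X : MatA 2 | ‖X - 1‖ < 1})] with X hX
    exact MatrixLog.exp_mlog hX
  have hid : HasFDerivAt (id : MatA 2 → MatA 2) ((1 : MatA 2 →L[ℂ] MatA 2).comp L) 1 := hcomp.congr_of_eventuallyEq hev.symm
  have huniq : (1 : MatA 2 →L[ℂ] MatA 2).comp L = ContinuousLinearMap.id ℂ (MatA 2) := hid.unique (hasFDerivAt_id 1)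
  rw [ContinuousLinearMap.one_def, ContinuousLinearMap.id_comp] at huniq
  rwa [huniq] at hm

/-- The same over ℝ. [cite: Balaban1985Averaging, (21) p.21 (bookkeeping)] -/
theorem hasFDerivAt_mlog_one_real : HasFDerivAt (MatrixLog.mlog : MatA 2 → MatA 2) (ContinuousLinearMap.id ℝ (MatA 2)) 1 :=
  hasFDerivAt_mlog_one.restrictScalars ℝ

/-! ## §2  `sl2Coord · c` as a continuous ℝ-linear functional -/

/-- The 𝔰𝔩₂-coordinate `A ↦ sl2Coord A c` as a continuous ℝ-linear map. [cite: Balaban1987RG1, (1.10) p.262 (bookkeeping)] -/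
theorem hasFDerivAt_sl2Coord (c : Fin 3) (A₀ : MatA 2) :
    ∃ L : MatA 2 →L[ℝ] ℂ, (∀ A, L A = sl2Coord A c) ∧ HasFDerivAt (fun A : MatA 2 => sl2Coord A c) L A₀ := by
  let Lℓ : MatA 2 →ₗ[ℝ] ℂ :=
    { toFun := fun A : MatA 2 => sl2Coord A c
      map_add' := fun A B => by rw [sl2Coord_add]; rfl
      map_smul' := fun r A => by
        show sl2Coord (r • A) c = r • sl2Coord A c
        rw [show r • A = ((r : ℂ) • A) by rw [Complex.coe_smul], sl2Coord_smul]
        rfl }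
  exact ⟨LinearMap.toContinuousLinearMap Lℓ, fun A => rfl, (LinearMap.toContinuousLinearMap Lℓ).hasFDerivAt⟩

/-! ## §3  The `log 𝐔`-block of the responses is the 𝔰𝔩₂-coordinate of the derivative of the background field -/

variable (F : T4Family) (θ : Stage13Params F 2)

/-- ★★ **LINEARISATION OF THE `log 𝐔`-BLOCK**: if the rooted-gauge background field `U : B ↦ (U_{k+1}(W_B)(b))_b` is differentiable at `B = 0` (standing range, `0 < εbg`),
then for every direction `δ` the derivative of the two-block embedding on a `𝐔`-coordinate `(b, c)` is `sl2Coord (DU(0)[δ](b)) c` — `D log(1) = id`.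
[cite: Balaban1987RG1, (4.35) p.290, p.258 («U_k = exp(iηH′)»); Balaban1985Variational, (182) p.307] -/
theorem hasFDerivAt_recordEmbJ_inl (k K : ℕ) (hk : k + 1 ≤ (F.P K).m + (F.P K).K) (hε : 0 < θ.εbg)
    (U' : letI := θ.instVβ₁; letI := θ.instVβ₂; (Fin (F.P K).d → Site (F.P K) (k + 1) → θ.Vβ) →L[ℝ] (PBond (F.P K) 0 → MatA 2))
    (hU : letI := θ.instVβ₁; letI := θ.instVβ₂;
      HasFDerivAt (fun B : Fin (F.P K).d → Site (F.P K) (k + 1) → θ.Vβ => fun b : PBond (F.P K) 0 => ((recordBgField F θ k K B b : SU 2) : MatA 2)) U' 0)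
    (b : PBond (F.P K) 0) (c : Fin 3) :
    letI := θ.instVβ₁; letI := θ.instVβ₂;
    ∃ L : (Fin (F.P K).d → Site (F.P K) (k + 1) → θ.Vβ) →L[ℝ] ℂ, (∀ δ, L δ = sl2Coord (U' δ b) c) ∧
      HasFDerivAt (fun B => recordEmbJ F θ k K B (chartEquivJ F K (b, Sum.inl c))) L 0 := by
  letI := θ.instVβ₁; letI := θ.instVβ₂
  -- the bond-`b` component of `U`
  have hUb : HasFDerivAt (fun B : Fin (F.P K).d → Site (F.P K) (k + 1) → θ.Vβ => ((recordBgField F θ k K B b : SU 2) : MatA 2))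
      ((ContinuousLinearMap.proj b).comp U') 0 := (hasFDerivAt_pi'.1 hU) b
  have h0 : ((recordBgField F θ k K 0 b : SU 2) : MatA 2) = 1 := by rw [recordBgField_zero F θ k K hk hε]; rfl
  have hm : HasFDerivAt (MatrixLog.mlog : MatA 2 → MatA 2) (ContinuousLinearMap.id ℝ (MatA 2)) ((recordBgField F θ k K 0 b : SU 2) : MatA 2) := by
    rw [h0]; exact hasFDerivAt_mlog_one_real
  obtain ⟨Lc, hLc, hc⟩ := hasFDerivAt_sl2Coord c (MatrixLog.mlog ((recordBgField F θ k K 0 b : SU 2) : MatA 2))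
  refine ⟨Lc.comp ((ContinuousLinearMap.id ℝ (MatA 2)).comp ((ContinuousLinearMap.proj b).comp U')), fun δ => ?_, ?_⟩
  · show Lc (U' δ b) = sl2Coord (U' δ b) c
    exact hLc _
  · have hfun : (fun B : Fin (F.P K).d → Site (F.P K) (k + 1) → θ.Vβ => recordEmbJ F θ k K B (chartEquivJ F K (b, Sum.inl c))) =
        fun B => sl2Coord (MatrixLog.mlog ((recordBgField F θ k K B b : SU 2) : MatA 2)) c := by
      funext B
      simp [recordEmbJ]
    rw [hfun]
    exact hc.comp 0 (hm.comp 0 hUb)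

/-- ★★ **`G_k` ON THE `𝐔`-COORDINATES = 𝔰𝔩₂-COORDINATES OF `DU(0)`**: under the same hypothesis, for every label `y` and colour `a`,
`recordGkJ F θ k K a y (b, c) = sl2Coord (DU(0)[δ_{y,a}](b)) c` with `δ_{y,a}` the basis field `Pi.single y.1 (Pi.single y.2 (bV a))` — [15]'s functional derivative (182)
read in the chart. [cite: Balaban1987RG1, (4.35) p.290; Balaban1985Variational, (182) p.307] -/
theorem recordGkJ_inl_eq (k K : ℕ) (hk : k + 1 ≤ (F.P K).m + (F.P K).K) (hε : 0 < θ.εbg)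
    (U' : letI := θ.instVβ₁; letI := θ.instVβ₂; (Fin (F.P K).d → Site (F.P K) (k + 1) → θ.Vβ) →L[ℝ] (PBond (F.P K) 0 → MatA 2))
    (hU : letI := θ.instVβ₁; letI := θ.instVβ₂;
      HasFDerivAt (fun B : Fin (F.P K).d → Site (F.P K) (k + 1) → θ.Vβ => fun b : PBond (F.P K) 0 => ((recordBgField F θ k K B b : SU 2) : MatA 2)) U' 0)
    (hE : letI := θ.instVβ₁; letI := θ.instVβ₂; DifferentiableAt ℝ (recordEmbJ F θ k K) 0)
    (a : θ.ιβ) (y : RespLabel F k K) (b : PBond (F.P K) 0) (c : Fin 3) :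
    letI := θ.instVβ₁; letI := θ.instVβ₂; letI := θ.instιβ;
    recordGkJ F θ k K a y (chartEquivJ F K (b, Sum.inl c)) = sl2Coord (U' (Pi.single y.1 (Pi.single y.2 (θ.bV a))) b) c := by
  letI := θ.instVβ₁; letI := θ.instVβ₂; letI := θ.instιβ
  obtain ⟨L, hL, hLd⟩ := hasFDerivAt_recordEmbJ_inl F θ k K hk hε U' hU b c
  have hcomp : HasFDerivAt (fun B => recordEmbJ F θ k K B (chartEquivJ F K (b, Sum.inl c)))
      ((ContinuousLinearMap.proj (chartEquivJ F K (b, Sum.inl c))).comp (fderiv ℝ (recordEmbJ F θ k K) 0)) 0 :=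
    (hasFDerivAt_pi'.1 hE.hasFDerivAt) _
  have huniq := hcomp.unique hLd
  show fderiv ℝ (recordEmbJ F θ k K) 0 (Pi.single y.1 (Pi.single y.2 (θ.bV a))) (chartEquivJ F K (b, Sum.inl c)) = _
  rw [← hL, ← huniq]
  rfl


/-! ## §4  The chart matrix of the responses: `Σ_c sl2Coord A c • τ_c` is the traceless part of `A`, and `DU(0)[δ](b)` IS traceless (`det U ≡ 1`) -/

/-- **𝔰𝔩₂-decomposition**: `Σ_c sl2Coord A c • τ_c = A − (tr A ∕ 2)·1` for every `2 × 2` matrix. [cite: Balaban1987RG1, (1.10) p.262 (bookkeeping)] -/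
theorem sum_sl2Coord_smul_sl2Gen (A : MatA 2) : ∑ c : Fin 3, sl2Coord A c • sl2Gen c = A - (A.trace / 2) • (1 : MatA 2) := by
  ext i j
  simp only [Fin.sum_univ_three, sl2Coord, sl2Gen, Matrix.trace, Matrix.diag, Fin.sum_univ_two]
  fin_cases i <;> fin_cases j <;> simp <;> ring

/-- Hence for a TRACELESS matrix the 𝔰𝔩₂-coordinates reassemble it exactly. [cite: Balaban1987RG1, (1.10) p.262 (bookkeeping)] -/
theorem sum_sl2Coord_smul_sl2Gen_of_trace_eq_zero {A : MatA 2} (hA : A.trace = 0) : ∑ c : Fin 3, sl2Coord A c • sl2Gen c = A := by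
  rw [sum_sl2Coord_smul_sl2Gen, hA, zero_div, zero_smul, sub_zero]

/-- A matrix entry as a continuous ℝ-linear functional, with its value. [folklore] -/
theorem exists_entryCLM (i j : Fin 2) : ∃ E : MatA 2 →L[ℝ] ℂ, ∀ A, E A = A i j :=
  ⟨LinearMap.toContinuousLinearMap ({ toFun := fun A : MatA 2 => A i j, map_add' := fun _ _ => rfl, map_smul' := fun _ _ => rfl } : MatA 2 →ₗ[ℝ] ℂ),
    fun _ => rfl⟩

/-- **THE DERIVATIVE OF AN `SU(2)`-VALUED FAMILY AT A POINT WHERE IT EQUALS `1` IS TRACELESS** (`det ≡ 1` differentiated: `tr DU = 0`).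
[cite: Balaban1987RG1, (1.10) p.262 («𝐉 … has values in 𝔤ᶜ»; bookkeeping)] -/
theorem trace_eq_zero_of_hasFDerivAt_su {E : Type*} [NormedAddCommGroup E] [NormedSpace ℝ E] {g : E → SU 2} {g' : E →L[ℝ] MatA 2} {e₀ : E}
    (hg : HasFDerivAt (fun e => ((g e : SU 2) : MatA 2)) g' e₀) (h1 : g e₀ = 1) (δ : E) : (g' δ).trace = 0 := by
  obtain ⟨E00, h00⟩ := exists_entryCLM 0 0
  obtain ⟨E11, h11⟩ := exists_entryCLM 1 1
  obtain ⟨E01, h01⟩ := exists_entryCLM 0 1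
  obtain ⟨E10, h10⟩ := exists_entryCLM 1 0
  have hd : ∀ e, ((g e : SU 2) : MatA 2) 0 0 * ((g e : SU 2) : MatA 2) 1 1 - ((g e : SU 2) : MatA 2) 0 1 * ((g e : SU 2) : MatA 2) 1 0 = 1 := by
    intro e
    rw [← Matrix.det_fin_two]
    exact (g e).2.2
  have hE : ∀ (Eij : MatA 2 →L[ℝ] ℂ), HasFDerivAt (fun e => Eij ((g e : SU 2) : MatA 2)) (Eij.comp g') e₀ := fun Eij => Eij.hasFDerivAt.comp e₀ hg
  have hprod := ((hE E00).mul (hE E11)).sub ((hE E01).mul (hE E10))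
  have hconst : HasFDerivAt (fun e => E00 ((g e : SU 2) : MatA 2) * E11 ((g e : SU 2) : MatA 2) - E01 ((g e : SU 2) : MatA 2) * E10 ((g e : SU 2) : MatA 2))
      (0 : E →L[ℝ] ℂ) e₀ := by
    have : (fun e => E00 ((g e : SU 2) : MatA 2) * E11 ((g e : SU 2) : MatA 2) - E01 ((g e : SU 2) : MatA 2) * E10 ((g e : SU 2) : MatA 2)) = fun _ => (1 : ℂ) := by
      funext e; rw [h00, h11, h01, h10]; exact hd e
    rw [this]
    exact hasFDerivAt_const 1 e₀
  have huniq := hprod.unique hconst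
  have happ := congrArg (fun L : E →L[ℝ] ℂ => L δ) huniq
  simp only [sub_apply, add_apply, smul_apply, ContinuousLinearMap.comp_apply, zero_apply, h00, h11, h01, h10, h1] at happ
  have e1 : (((1 : SU 2) : MatA 2)) = 1 := rfl
  rw [e1] at happ
  simp only [Matrix.one_apply_eq, Matrix.one_apply_ne (show (0 : Fin 2) ≠ 1 by decide), Matrix.one_apply_ne (show (1 : Fin 2) ≠ 0 by decide)] at happ
  rw [Matrix.trace_fin_two]
  linear_combination happ

open scoped Classical in
/-- ★★ **THE `𝐔`-BLOCK CHART MATRIX OF A RESPONSE IS THE DERIVATIVE OF THE BACKGROUND FIELD**: under the hypotheses of `recordGkJ_inl_eq`, on a bond `b ∈ X`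
the `𝐔`-block chart matrix of the CUT response `cutTo (recordCXJ X) (recordGkJ … a y)` is `DU(0)[δ_{y,a}](b)` itself (traceless by `det U ≡ 1`), and it is `0` on a bond
`b ∉ X`.  This is the entry of (R1ᴰ)'s gauge through the first three clauses of `recordDom44J`. [cite: Balaban1987RG1, (4.4) p.281, (4.35) p.290; Balaban1985Variational, (182) p.307] -/
theorem chartMatU_cutTo_recordGkJ (k K : ℕ) (hk : k + 1 ≤ (F.P K).m + (F.P K).K) (hε : 0 < θ.εbg)
    (U' : letI := θ.instVβ₁; letI := θ.instVβ₂; (Fin (F.P K).d → Site (F.P K) (k + 1) → θ.Vβ) →L[ℝ] (PBond (F.P K) 0 → MatA 2))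
    (hU : letI := θ.instVβ₁; letI := θ.instVβ₂;
      HasFDerivAt (fun B : Fin (F.P K).d → Site (F.P K) (k + 1) → θ.Vβ => fun b : PBond (F.P K) 0 => ((recordBgField F θ k K B b : SU 2) : MatA 2)) U' 0)
    (hE : letI := θ.instVβ₁; letI := θ.instVβ₂; DifferentiableAt ℝ (recordEmbJ F θ k K) 0)
    (a : θ.ιβ) (y : RespLabel F k K) {Mc : ℕ} (X : (recordDomSys F Mc k K).Dom) (b : PBond (F.P K) 0) :
    letI := θ.instVβ₁; letI := θ.instVβ₂; letI := θ.instιβ;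
    chartMatU F K (B12FormatPlus.cutTo (recordCXJ F Mc k K X) (recordGkJ F θ k K a y)) b =
      if b ∈ domBonds F Mc k K X then U' (Pi.single y.1 (Pi.single y.2 (θ.bV a))) b else 0 := by
  letI := θ.instVβ₁; letI := θ.instVβ₂; letI := θ.instιβ
  classical
  have hmem : ∀ c : Fin 3, chartEquivJ F K (b, Sum.inl c) ∈ recordCXJ F Mc k K X ↔ b ∈ domBonds F Mc k K X := fun c => by simp [recordCXJ]
  by_cases hb : b ∈ domBonds F Mc k K X
  · rw [if_pos hb]
    have htr : (U' (Pi.single y.1 (Pi.single y.2 (θ.bV a))) b).trace = 0 := by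
      have hUb : HasFDerivAt (fun B : Fin (F.P K).d → Site (F.P K) (k + 1) → θ.Vβ => ((recordBgField F θ k K B b : SU 2) : MatA 2))
          ((ContinuousLinearMap.proj b).comp U') 0 := (hasFDerivAt_pi'.1 hU) b
      have h1 : recordBgField F θ k K 0 b = 1 := by rw [recordBgField_zero F θ k K hk hε]; rfl
      exact trace_eq_zero_of_hasFDerivAt_su hUb h1 _
    rw [← sum_sl2Coord_smul_sl2Gen_of_trace_eq_zero htr]
    unfold chartMatU
    refine Finset.sum_congr rfl fun c _ => ?_
    rw [B12FormatPlus.cutTo_apply, if_pos ((hmem c).2 hb), recordGkJ_inl_eq F θ k K hk hε U' hU hE a y b c]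
  · rw [if_neg hb]
    unfold chartMatU
    refine Finset.sum_eq_zero fun c _ => ?_
    rw [B12FormatPlus.cutTo_apply, if_neg (mt (hmem c).1 hb), zero_smul]

end Summit.QuantumFields.YangMills.Theorems.PortU8

end
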